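/-
Copyright (c) 2026 the pub-hodgecm-mathlib formalisation cell (harness21).  Prover seat hodgecm-mathlib-LH4-p06 (g4), Track A «(D-RAM) FOUR-FRAME», unit U2H, census leaf
(ρ2b′-X) — T5c «TORIC LEVEL CENSUS, M∕E-RAMIFIED»: the u-FREE ROWS OF THE DEPTH-REFINED CENSUS `levelSetDep` (sheet v5 (D0)(D1)(D2)), twin of LH4-p08 (g4)'s type-U file
`F0P3cDyRamToricLevelCensusUnrDep` in the ramified tokens (`|ϖE| = exp(−2)`, `|α − ρα| = exp(−d_ρ)`).  2026-09-04.
-/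
import Summits.HodgeConjecture.HodgeConjecture.Theorems.F0P3cDyRamToricLevelCensusRamM   -- ★ p857418∕p857497 (this seat): the head (datum letters `v_sub_map_eq_exp_of_datum`, `map_ne_self_of_datum`); brings ★ DEFS p857239
import Literature.NumberTheory.LocalFields.QuadraticOrderDepthScaling                   -- ★ p857268 (this seat): (D0) `forall_dual_mul_mem_iff_depthUnit` (type-free)
import Literature.NumberTheory.LocalFields.QuadraticOrderLevelClassesRamified            -- ★ p857372 (this seat): `exists_eq_uniformizer_zpow_mul_unit`, `normTwist_mul`, `hermGenR_level_iff_of_pos ∕ _zero`, `v_varpiE_pow`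
import Literature.NumberTheory.LocalFields.QuadraticOrderHermitianLevel                  -- ★ p857226 (LH4-p08 (g4)): `map_hermGen_eq_neg_mul`, `v_hermGen_sub_map_eq`, `v_depthQuot_sub_map_eq` (type-free)
import Literature.NumberTheory.LocalFields.QuadraticOrderNormDepthIndexTwoRamified       -- ★ p857465 (this seat): `v_sub_map_le_pow_of_v_le_one` (the unit different bound `|u − ρu| ≤ |α|^{d_ρ}`)
import HarnessLib

/-!
# T5c: the u-free rows of the depth-refined level census `levelSetDep`, M∕E-RAMIFIED frame (sheet v5 (D0)(D1)(D2))

Cell `hodgecm-mathlib` (D-0151), FLOOR 0, crux H413 = `stmt-HodgeConjecture-24833`; squad F0∕P3c∕LH4; lane `--supports stmt-HodgeConjecture-24833 --as helper` (count-neutral).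
THEOREMS ONLY (no `def`, no instance, no notation, no `sorry`).  Socket served: MAP v1 seam S6 (LH4-p14 (g4)) — «the tables `#levelSetDep(j, a; μ)` in closed form per
descent type»; this is the type-RamM table off the coincidence diagonal (the twin of LH4-p08 (g4)'s type-U rows (R1-A0)(R1-OFF)(R1-DIAG-LOW)).

TOKENS (ramified frame; `(M, ρ, α, d_ρ)` a ★ ramified quadratic datum, `Θ` an isometric involution commuting with `ρ`, `ϖE` `ρ`-fixed with `|ϖE| = exp(−2)`, `h ≠ 0`):
`|μ| = |ϖE|^m` (`= exp(−2m)`), `|μ − ρμ| = |ϖE^{jλ}(α − ρα)|` (`= exp(−2jλ − d_ρ)`: `λ ∈ 𝒪_{jλ} ∖ 𝒪_{jλ+1}` read on `μ = λ − u`), level `a` (`|y| = |ϖE|^a`), tree level `j`.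
THE MECHANISM (all ★): by ★ (D0) the depth clause `μΛ^# ⊆ Λ` of `Λ = x₀𝒪_j ∈ levelSet(j,a)` is `a ≤ m ∧ (j + a ≤ m ∨ |z − ρz| ≤ exp(2m − 2a − 2j − d_ρ))` for the UNIT
`z := μ∕(y·ϖE^{m−a})`; `|z − ρz| = |(1 + θ) + (κ − 1)|` with `ρy = −θy` (★ `map_hermGen_eq_neg_mul`, ★ `v_depthQuot_sub_map_eq`), `|1 + θ| = exp(2a − 2j − d_ρ)` for `a ≥ 1`
(`≤ exp(−(2j + d_ρ))` for `a = 0`; ★ `hermGenR_level_iff_of_pos ∕ _zero`) and `|κ − 1| = |ρμ∕μ − 1| = exp(2m − 2jλ − d_ρ)`.  Hence, u-FREE: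
* §1 `dep_iff_of_witness_ramified`, `v_depthUnit_sub_map_eq_ramified`, `v_one_add_twist_of_gen_ramified` (incl. `a ≤ j`: non-empty levels lie below the tree level).
* §2 **(R1-A0) `levelSetDep_zero_eq_of_ramified`** (`a = 0`, `j ≤ jλ`: every lattice passes); **(D1) `levelSetDep_eq_levelSet_of_gen_ramified`** (`a ≥ 1`,
  `GEN := a ≤ m ∧ (j ≤ m − a ∨ (2a ≤ m ∧ j + a ≤ jλ))` ⇒ every lattice passes — on or off the diagonal, by the ultrametric max bound); **(D2)
  `levelSetDep_eq_empty_of_not_gen_ramified`** (`a ≥ 1`, `¬GEN`, off the diagonal `j + m ≠ jλ + a` ⇒ none passes — ★ `Valuation.map_add_of_distinct_val`); the packaged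
  `levelSetDep_eq_of_generic_ramified` (`= if GEN then levelSet else ∅`) and its `ncard` form — sheet v5 (D1)(D2) (E1: 2139∕2139 + 1548∕1548 cells).
The TOP HALF of the diagonal (`¬GEN`, `j + m = jλ + a`: the sign cells (D3)) is class-sensitive and NOT in this file.
HONEST LABEL.  Count-neutral (`--supports`); unconditional algebra over ★ organs; the census LAW (ρ2b′-X) is NOT asserted — `HC_CM` is proved only modulo the 7 printed citations
(2 remaining named inputs: hLiu418 = `stmt-HodgeConjecture-24832`, h413 = `stmt-HodgeConjecture-24833`) until rung 0 closes.

## References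
* [Jacobowitz1962] R. Jacobowitz, *Hermitian forms over local fields*, Amer. J. Math. 84 (1962): §4 (duals, modular lattices).
* [Serre1979] J.-P. Serre, *Local Fields*, GTM 67 (1979): Ch. III §6 Prop. 12; Ch. IV §1 Prop. 3–4; Ch. V §3.
* [Kottwitz1986BaseChangeUnits] R. E. Kottwitz, *Base change for unit elements of Hecke algebras*, Compositio Math. 60 (1986): §1 pp. 240–241 (the tube ∕ depth condition).
-/

set_option autoImplicit false

noncomputable section

namespace Summit.HodgeConjecture.HodgeConjecture.Cruxes.H413.F0P3cDyRamToricLevelCensusRamM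

open WithZero
open Literature.NumberTheory.Automorphic.UnitaryThreeFourFrame (IsRamifiedQuadraticDatum)
open Literature.NumberTheory.LocalFields.QuadraticOrder
open Summit.HodgeConjecture.HodgeConjecture.Cruxes.H413.F0P3cDyRamToricCensusDefs

variable {K : Type} [Field K] [Valued K ℤᵐ⁰] {ρ Θ : K →+* K} {α ϖE h : K} {dρ t : ℕ}

/-! ## §1 The depth unit and its twist (ramified tokens) -/

/-- Integrality of `(z − ρz)∕(α − ρα)` for integral `z` — the datum's different bound `|z − ρz| ≤ |α|^{d_ρ} = |α − ρα|` (★ Eisenstein coordinates).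
[cite: Serre1979, Ch. IV §1 Prop. 3–4] -/
theorem v_sub_map_div_le_one_of_datum (hD : IsRamifiedQuadraticDatum ρ α dρ t) (z : K) (hz : Valued.v z ≤ 1) :
    Valued.v ((z - ρ z) / (α - ρ α)) ≤ 1 := by
  obtain ⟨hρρ, -, hα, hfix, hdd, -, -⟩ := id hD
  have hδ0 : Valued.v (α - ρ α) ≠ 0 := by rw [v_sub_map_eq_exp_of_datum hD]; exact exp_ne_zero
  rw [map_div₀, div_le_one₀ (zero_lt_iff.2 hδ0), hdd]
  exact v_sub_map_le_pow_of_v_le_one hρρ hfix hα hdd hz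

/-- **An element of EVEN level is moved by `d_ρ`**: `|y| = |ϖE|^a` ⇒ `|y − ρy| ≤ |y|·exp(−d_ρ)` (`y = u·ϖE^a` with `u` a unit, `ρϖE = ϖE`, and `|u − ρu| ≤ |α|^{d_ρ}`).
[cite: Serre1979, Ch. IV §1 Prop. 3–4] -/
theorem v_sub_map_le_mul_exp_of_level (hD : IsRamifiedQuadraticDatum ρ α dρ t) (hρϖ : ρ ϖE = ϖE) (hϖE : Valued.v ϖE = exp (-2 : ℤ))
    {y : K} {a : ℕ} (hy : Valued.v y = Valued.v ϖE ^ a) : Valued.v (y - ρ y) ≤ Valued.v y * exp (-(dρ : ℤ)) := by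
  obtain ⟨hρρ, -, hα, hfix, hdd, -, -⟩ := id hD
  have hϖ0 : ϖE ≠ 0 := fun h0 => by rw [h0, map_zero] at hϖE; exact exp_ne_zero hϖE.symm
  have hne : ϖE ^ a ≠ 0 := pow_ne_zero _ hϖ0
  have hvne : Valued.v (ϖE ^ a) ≠ 0 := (Valuation.ne_zero_iff _).2 hne
  set u : K := y / ϖE ^ a with hu
  have hu1 : Valued.v u = 1 := by rw [hu, map_div₀, hy, map_pow, div_self (by rwa [map_pow] at hvne)]
  have hyu : y = u * ϖE ^ a := by rw [hu, div_mul_cancel₀ y hne]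
  have hsub : y - ρ y = (u - ρ u) * ϖE ^ a := by rw [hyu, map_mul, map_pow, hρϖ]; ring
  have hbd : Valued.v (u - ρ u) ≤ exp (-(dρ : ℤ)) := by
    refine (v_sub_map_le_pow_of_v_le_one hρρ hfix hα hdd hu1.le).trans_eq ?_
    rw [hα, ← exp_nsmul, nsmul_eq_mul, mul_neg, mul_one]
  have hvy : Valued.v y = Valued.v (ϖE ^ a) := by rw [hyu, map_mul, hu1, one_mul]
  rw [hsub, map_mul, hvy, mul_comm]
  exact mul_le_mul' le_rfl hbd

/-- **THE DEPTH CONDITION READ ON A MEMBER OF A LEVEL SET, RAMIFIED TOKENS (★ (D0) `forall_dual_mul_mem_iff_depthUnit`).**  For `Λ = x₀·𝒪_j` with `|y| = |ϖE|^a` (`y = dualGen x₀`)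
and `|μ| = |ϖE|^m`: `μΛ^# ⊆ Λ ⟺ a ≤ m ∧ (j + a ≤ m ∨ |z − ρz| ≤ exp(2m − 2a − 2j − d_ρ))`, `z := μ∕(y·ϖE^{m−a})` (a unit).
[cite: Kottwitz1986BaseChangeUnits, §1 pp. 240–241] [cite: Jacobowitz1962, §4] [cite: Serre1979, Ch. III §6 Prop. 12] -/
theorem dep_iff_of_witness_ramified (hD : IsRamifiedQuadraticDatum ρ α dρ t) (hΘΘ : ∀ x, Θ (Θ x) = x) (hΘρ : ∀ x, Θ (ρ x) = ρ (Θ x))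
    (hvΘ : ∀ x, Valued.v (Θ x) = Valued.v x) (hρϖ : ρ ϖE = ϖE) (hϖE : Valued.v ϖE = exp (-2 : ℤ)) (hh : h ≠ 0)
    {μ : K} {m : ℕ} (hμ : Valued.v μ = Valued.v ϖE ^ m) {j a : ℕ} {Λ : AddSubgroup K} {x₀ : K} (hx₀ : x₀ ≠ 0)
    (hΛ : ∀ x, x ∈ Λ ↔ ∃ z, IsOrd ρ α (ϖE ^ j) z ∧ x = x₀ * z) (hya : Valued.v (dualGen ρ Θ α (ϖE ^ j) h x₀) = Valued.v ϖE ^ a) :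
    (∀ b, (∀ x ∈ Λ, Valued.v (h * Θ x * b + ρ (h * Θ x * b)) ≤ 1) → μ * b ∈ Λ) ↔
      a ≤ m ∧ (j + a ≤ m ∨
        Valued.v (μ / (dualGen ρ Θ α (ϖE ^ j) h x₀ * ϖE ^ (m - a)) - ρ (μ / (dualGen ρ Θ α (ϖE ^ j) h x₀ * ϖE ^ (m - a)))) ≤
          exp (2 * (m : ℤ) - 2 * a - 2 * j - dρ)) := by
  obtain ⟨hρρ, hvρ, hα, -, -, -, -⟩ := id hD
  have hρα := map_ne_self_of_datum hD
  have hδ := v_sub_map_eq_exp_of_datum hD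
  have hint := v_sub_map_div_le_one_of_datum hD
  have hα1 : Valued.v α ≤ 1 := by rw [hα, ← exp_zero, exp_le_exp]; norm_num
  have hϖ0 : ϖE ≠ 0 := fun h0 => by rw [h0, map_zero] at hϖE; exact exp_ne_zero hϖE.symm
  have hϖ1 : Valued.v ϖE < 1 := by rw [hϖE, ← exp_zero, exp_lt_exp]; norm_num
  have hbd : ¬ j + a ≤ m → a ≤ m → Valued.v (ϖE ^ (j - (m - a)) * (α - ρ α)) = exp (2 * (m : ℤ) - 2 * a - 2 * j - dρ) := fun hjam ham => by
    rw [map_mul, hδ, map_pow, v_varpiE_pow hϖE, ← exp_add]; congr 1; omega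
  simp only [dualGen] at hya ⊢
  rw [forall_dual_mul_mem_iff_depthUnit hρρ hvρ hρα hα1 hint hΘΘ hΘρ hvΘ hρϖ hϖ0 hϖ1 hh hx₀ j hΛ hya hμ]
  constructor
  · rintro ⟨ham, hor⟩
    refine ⟨ham, ?_⟩
    by_cases hjam : j + a ≤ m
    · exact Or.inl hjam
    · rcases hor with hjm | ⟨-, hz⟩
      · exact Or.inl (by omega)
      · exact Or.inr (hz.trans_eq (hbd hjam ham))
  · rintro ⟨ham, hor⟩
    refine ⟨ham, ?_⟩
    by_cases hjam : j + a ≤ m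
    · exact Or.inl (by omega)
    · rcases hor with hjam' | hz
      · exact absurd hjam' hjam
      · right
        refine ⟨?_, hz.trans_eq (hbd hjam ham).symm⟩
        rw [map_div₀, map_mul, hya, map_pow, hμ, ← pow_add, Nat.add_sub_cancel' ham,
          div_self (pow_ne_zero _ ((Valuation.ne_zero_iff _).2 hϖ0))]

/-- **THE `ρ`-TWIST OF THE DEPTH UNIT, RAMIFIED TOKENS**: for `x₀ ≠ 0`, `y = h·x₀Θx₀·ϖE^j(α − ρα)` with `|y| = |ϖE|^a`, `a ≤ m`, `|μ| = |ϖE|^m`, `|μ − ρμ| = |ϖE^{jλ}(α − ρα)|`: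
`|z − ρz| = |(1 + θ) + (κ − 1)|` (`θ = (ρh∕h)(ρN∕N)`, `ρy = −θy`, ★ `map_hermGen_eq_neg_mul` ∕ `v_depthQuot_sub_map_eq`) and `|κ − 1| = exp(2m − 2jλ − d_ρ)` (`κ = ρμ∕μ`).
[cite: Jacobowitz1962, §4] [cite: Serre1979, Ch. V §3] -/
theorem v_depthUnit_sub_map_eq_ramified (hD : IsRamifiedQuadraticDatum ρ α dρ t) (hρϖ : ρ ϖE = ϖE) (hϖE : Valued.v ϖE = exp (-2 : ℤ)) (hh : h ≠ 0)
    {μ : K} {m jl : ℕ} (hμ : Valued.v μ = Valued.v ϖE ^ m) (hjl : Valued.v (μ - ρ μ) = Valued.v (ϖE ^ jl * (α - ρ α)))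
    {j a : ℕ} (ham : a ≤ m) {x₀ : K} (hx₀ : x₀ ≠ 0) (hya : Valued.v (h * (x₀ * Θ x₀) * (ϖE ^ j * (α - ρ α))) = Valued.v ϖE ^ a) :
    Valued.v (μ / (h * (x₀ * Θ x₀) * (ϖE ^ j * (α - ρ α)) * ϖE ^ (m - a)) - ρ (μ / (h * (x₀ * Θ x₀) * (ϖE ^ j * (α - ρ α)) * ϖE ^ (m - a)))) =
        Valued.v ((1 + ρ h / h * (ρ (x₀ * Θ x₀) / (x₀ * Θ x₀))) + (ρ μ / μ - 1)) ∧
      Valued.v (ρ μ / μ - 1) = exp (2 * (m : ℤ) - 2 * jl - dρ) := by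
  -- adapted from LH4-p08 (g4)'s type-U `v_depthUnit_sub_map_eq` (tokens doubled, `d_ρ` carried)
  obtain ⟨hρρ, hvρ, -, -, -, -, -⟩ := id hD
  have hδ := v_sub_map_eq_exp_of_datum hD
  have hϖ0 : ϖE ≠ 0 := fun h0 => by rw [h0, map_zero] at hϖE; exact exp_ne_zero hϖE.symm
  have hμ0 : μ ≠ 0 := fun h0 => by
    rw [h0, map_zero, v_varpiE_pow hϖE] at hμ; exact exp_ne_zero hμ.symm
  have hΘx₀ : Θ x₀ ≠ 0 := (map_ne_zero Θ).2 hx₀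
  have hN0 : x₀ * Θ x₀ ≠ 0 := mul_ne_zero hx₀ hΘx₀
  have hc : ρ (ϖE ^ j) = ϖE ^ j := by rw [map_pow, hρϖ]
  have hy0 : h * (x₀ * Θ x₀) * (ϖE ^ j * (α - ρ α)) ≠ 0 := fun h0 => by
    rw [h0, map_zero, v_varpiE_pow hϖE] at hya; exact exp_ne_zero hya.symm
  have hρy := map_hermGen_eq_neg_mul (ρ := ρ) (Θ := Θ) (α := α) hρρ hc hh hx₀ hΘx₀
  have hθ : Valued.v (ρ h / h * (ρ (x₀ * Θ x₀) / (x₀ * Θ x₀))) = 1 := by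
    rw [map_mul, map_div₀, map_div₀, hvρ, hvρ, div_self ((Valuation.ne_zero_iff _).2 hh),
      div_self ((Valuation.ne_zero_iff _).2 hN0), mul_one]
  have hy'0 : h * (x₀ * Θ x₀) * (ϖE ^ j * (α - ρ α)) * ϖE ^ (m - a) ≠ 0 := mul_ne_zero hy0 (pow_ne_zero _ hϖ0)
  have hρy' : ρ (h * (x₀ * Θ x₀) * (ϖE ^ j * (α - ρ α)) * ϖE ^ (m - a)) =
      -(ρ h / h * (ρ (x₀ * Θ x₀) / (x₀ * Θ x₀)) * (h * (x₀ * Θ x₀) * (ϖE ^ j * (α - ρ α)) * ϖE ^ (m - a))) := by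
    rw [map_mul ρ _ (ϖE ^ (m - a)), map_pow, hρϖ, hρy]; ring
  have key := v_depthQuot_sub_map_eq (ρ := ρ) hρy' hθ hy'0 (map_zero ρ) hμ0
  simp only [sub_zero] at key
  have hvz : Valued.v (μ / (h * (x₀ * Θ x₀) * (ϖE ^ j * (α - ρ α)) * ϖE ^ (m - a))) = 1 := by
    rw [map_div₀, map_mul, hya, map_pow, hμ, ← pow_add, Nat.add_sub_cancel' ham,
      div_self (pow_ne_zero _ ((Valuation.ne_zero_iff _).2 hϖ0))]
  refine ⟨by rw [key.1, hvz, one_mul], ?_⟩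
  rw [key.2, hjl, map_mul, map_pow, hδ, hμ, v_varpiE_pow hϖE, v_varpiE_pow hϖE, ← exp_add, ← exp_sub]
  congr 1; ring

/-- **THE TWIST DEPTH OF A GENERATOR, RAMIFIED TOKENS**: for `x₀` witnessing `Λ ∈ levelSet(j,a)` (`y` integral, Gram-primitive, `|y| = |ϖE|^a`):
`|1 + θ| = exp(2a − 2j − d_ρ)` if `a ≥ 1`, `|1 + θ| ≤ exp(−(2j + d_ρ))` if `a = 0` (★ `hermGenR_level_iff_of_pos ∕ _zero` on `x₀ = α^k·ω`), and `a ≤ j`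
(`|1 + θ| = |y − ρy|∕|y| ≤ exp(−d_ρ)`). [cite: Jacobowitz1962, §4] [cite: Serre1979, Ch. V §3] -/
theorem v_one_add_twist_of_gen_ramified (hD : IsRamifiedQuadraticDatum ρ α dρ t) (hvΘ : ∀ x, Valued.v (Θ x) = Valued.v x)
    (hρϖ : ρ ϖE = ϖE) (hϖE : Valued.v ϖE = exp (-2 : ℤ)) (hh : h ≠ 0) {j a : ℕ} {x₀ : K} (hx₀ : x₀ ≠ 0)
    (hyO : IsOrd ρ α (ϖE ^ j) (h * (x₀ * Θ x₀) * (ϖE ^ j * (α - ρ α))))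
    (hyN : ¬ IsOrd ρ α (ϖE ^ j) (h * (x₀ * Θ x₀) * (ϖE ^ j * (α - ρ α)) / ϖE))
    (hya : Valued.v (h * (x₀ * Θ x₀) * (ϖE ^ j * (α - ρ α))) = Valued.v ϖE ^ a) :
    (1 ≤ a → Valued.v (1 + ρ h / h * (ρ (x₀ * Θ x₀) / (x₀ * Θ x₀))) = exp (2 * (a : ℤ) - 2 * j - dρ)) ∧
      (a = 0 → Valued.v (1 + ρ h / h * (ρ (x₀ * Θ x₀) / (x₀ * Θ x₀))) ≤ exp (-(2 * (j : ℤ) + dρ))) ∧ a ≤ j := by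
  obtain ⟨hρρ, -, hα, hfix, -, -, -⟩ := id hD
  have hρα := map_ne_self_of_datum hD
  have hδ := v_sub_map_eq_exp_of_datum hD
  have hvh0 : Valued.v h ≠ 0 := (Valuation.ne_zero_iff _).2 hh
  have hvh : Valued.v h = exp (-(-log (Valued.v h))) := by rw [neg_neg, exp_log hvh0]
  have hΘx₀ : Θ x₀ ≠ 0 := (map_ne_zero Θ).2 hx₀
  obtain ⟨k, ω, hω, hxω⟩ := exists_eq_uniformizer_zpow_mul_unit hα hx₀
  have hω0 : ω ≠ 0 := fun h0 => by rw [h0, map_zero] at hω; exact zero_ne_one hω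
  have hαk0 : α ^ k ≠ 0 := fun h0 => hx₀ (by rw [hxω, h0, zero_mul])
  -- the twist of `x₀ = α^k·ω` splits (★ `normTwist_mul`)
  have htw : ρ h / h * (ρ (x₀ * Θ x₀) / (x₀ * Θ x₀)) = ρ h / h * ((ρ (α ^ k * Θ (α ^ k)) / (α ^ k * Θ (α ^ k))) * (ρ (ω * Θ ω) / (ω * Θ ω))) := by
    rw [hxω, normTwist_mul hαk0 hω0]
  subst hxω
  have hpos : 1 ≤ a → Valued.v (1 + ρ h / h * (ρ (α ^ k * ω * Θ (α ^ k * ω)) / (α ^ k * ω * Θ (α ^ k * ω)))) = exp (2 * (a : ℤ) - 2 * j - dρ) :=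
    fun ha => by
      rw [htw]
      exact ((hermGenR_level_iff_of_pos hρρ hvΘ hfix hρα hα hδ hϖE hρϖ hh hvh j ha (k := k) hω).1 ⟨⟨hyO, hyN⟩, hya⟩).2
  refine ⟨hpos, fun ha0 => ?_, ?_⟩
  · subst ha0
    rw [htw]
    exact ((hermGenR_level_iff_zero hρρ hvΘ hfix hρα hα hδ hϖE hρϖ hh hvh j (k := k) hω).1 ⟨⟨hyO, hyN⟩, hya⟩).2
  · by_cases ha : 1 ≤ a
    · -- `|1 + θ| = |y − ρy|∕|y| ≤ exp(−d_ρ)`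
      have hb := v_sub_map_le_mul_exp_of_level hD hρϖ hϖE hya
      rw [v_hermGen_sub_map_eq hρρ (c := ϖE ^ j) (by rw [map_pow, hρϖ]) hh hx₀ hΘx₀, hpos ha] at hb
      have hy0 : 0 < Valued.v (h * (α ^ k * ω * Θ (α ^ k * ω)) * (ϖE ^ j * (α - ρ α))) := by
        rw [hya, v_varpiE_pow hϖE]; exact zero_lt_iff.2 exp_ne_zero
      have h1 := le_of_mul_le_mul_left hb hy0
      rw [exp_le_exp] at h1
      omega
    · omega

/-! ## §2 The u-free rows (R1-A0), (D1), (D2) -/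

/-- **(R1-A0) LEVEL 0 ALWAYS PASSES (RamM)**: `levelSetDep(j, 0; μ) = levelSet(j, 0)` for `|μ| = |ϖE|^m`, `|μ − ρμ| = |ϖE^{jλ}(α − ρα)|`, `j ≤ jλ` (the depth unit has
`|z − ρz| ≤ max(exp(−(2j + d_ρ)), exp(2m − 2jλ − d_ρ)) ≤ exp(2m − 2j − d_ρ)`). [cite: Jacobowitz1962, §4] [cite: Kottwitz1986BaseChangeUnits, §1 pp. 240–241] -/
theorem levelSetDep_zero_eq_of_ramified (hD : IsRamifiedQuadraticDatum ρ α dρ t) (hΘΘ : ∀ x, Θ (Θ x) = x) (hΘρ : ∀ x, Θ (ρ x) = ρ (Θ x))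
    (hvΘ : ∀ x, Valued.v (Θ x) = Valued.v x) (hρϖ : ρ ϖE = ϖE) (hϖE : Valued.v ϖE = exp (-2 : ℤ)) (hh : h ≠ 0)
    {μ : K} {m jl : ℕ} (hμ : Valued.v μ = Valued.v ϖE ^ m) (hjl : Valued.v (μ - ρ μ) = Valued.v (ϖE ^ jl * (α - ρ α))) {j : ℕ} (hj : j ≤ jl) :
    levelSetDep ρ Θ α ϖE h j 0 μ = levelSet ρ Θ α ϖE h j 0 := by
  ext Λ
  rw [mem_levelSetDep_iff]
  refine ⟨fun hΛ => hΛ.1, fun hΛ => ⟨hΛ, ?_⟩⟩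
  obtain ⟨x₀, hx₀, hΛx, hyO, hyN, hya⟩ := hΛ
  rw [dep_iff_of_witness_ramified hD hΘΘ hΘρ hvΘ hρϖ hϖE hh hμ hx₀ hΛx hya]
  refine ⟨Nat.zero_le _, ?_⟩
  by_cases hjm : j + 0 ≤ m
  · exact Or.inl hjm
  right
  simp only [dualGen] at hyO hyN hya ⊢
  obtain ⟨hz, hκ⟩ := v_depthUnit_sub_map_eq_ramified hD hρϖ hϖE hh hμ hjl (Nat.zero_le m) hx₀ hya
  obtain ⟨-, hzero, -⟩ := v_one_add_twist_of_gen_ramified hD hvΘ hρϖ hϖE hh hx₀ hyO hyN hya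
  rw [hz]
  refine (Valuation.map_add _ _ _).trans (max_le ((hzero rfl).trans ?_) (hκ.trans_le ?_))
  · rw [exp_le_exp]; omega
  · rw [exp_le_exp]; omega

/-- **(D1) THE GENERIC RULE, PASSING HALF (RamM)**: for `a ≥ 1` and `GEN(j,a) := a ≤ m ∧ (j ≤ m − a ∨ (2a ≤ m ∧ j + a ≤ jλ))`, EVERY lattice of the level passes:
`levelSetDep(j,a;μ) = levelSet(j,a)` — on or off the diagonal (`|z − ρz| ≤ max(exp(2a − 2j − d_ρ), exp(2m − 2jλ − d_ρ)) ≤ exp(2m − 2a − 2j − d_ρ)`).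
[cite: Jacobowitz1962, §4] [cite: Kottwitz1986BaseChangeUnits, §1 pp. 240–241] -/
theorem levelSetDep_eq_levelSet_of_gen_ramified (hD : IsRamifiedQuadraticDatum ρ α dρ t) (hΘΘ : ∀ x, Θ (Θ x) = x) (hΘρ : ∀ x, Θ (ρ x) = ρ (Θ x))
    (hvΘ : ∀ x, Valued.v (Θ x) = Valued.v x) (hρϖ : ρ ϖE = ϖE) (hϖE : Valued.v ϖE = exp (-2 : ℤ)) (hh : h ≠ 0)
    {μ : K} {m jl : ℕ} (hμ : Valued.v μ = Valued.v ϖE ^ m) (hjl : Valued.v (μ - ρ μ) = Valued.v (ϖE ^ jl * (α - ρ α)))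
    {j a : ℕ} (ha : 1 ≤ a) (hgen : a ≤ m ∧ (j ≤ m - a ∨ (2 * a ≤ m ∧ j + a ≤ jl))) :
    levelSetDep ρ Θ α ϖE h j a μ = levelSet ρ Θ α ϖE h j a := by
  ext Λ
  rw [mem_levelSetDep_iff]
  refine ⟨fun hΛ => hΛ.1, fun hΛ => ⟨hΛ, ?_⟩⟩
  obtain ⟨x₀, hx₀, hΛx, hyO, hyN, hya⟩ := hΛ
  rw [dep_iff_of_witness_ramified hD hΘΘ hΘρ hvΘ hρϖ hϖE hh hμ hx₀ hΛx hya]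
  obtain ⟨ham, hor⟩ := hgen
  refine ⟨ham, ?_⟩
  by_cases hjam : j + a ≤ m
  · exact Or.inl hjam
  right
  have h2 : 2 * a ≤ m ∧ j + a ≤ jl := by
    rcases hor with h1 | h2
    · exfalso; omega
    · exact h2
  simp only [dualGen] at hyO hyN hya ⊢
  obtain ⟨hz, hκ⟩ := v_depthUnit_sub_map_eq_ramified hD hρϖ hϖE hh hμ hjl ham hx₀ hya
  obtain ⟨hpos, -, -⟩ := v_one_add_twist_of_gen_ramified hD hvΘ hρϖ hϖE hh hx₀ hyO hyN hya
  rw [hz]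
  refine (Valuation.map_add _ _ _).trans (max_le ((hpos ha).trans_le ?_) (hκ.trans_le ?_))
  · rw [exp_le_exp]; omega
  · rw [exp_le_exp]; omega

/-- **(D2) THE GENERIC RULE, EMPTY HALF (RamM)**: for `a ≥ 1`, `¬GEN(j,a)` and OFF the coincidence diagonal `j + m ≠ jλ + a`, NO lattice of the level passes:
`levelSetDep(j,a;μ) = ∅` (`|z − ρz| = max(exp(2a − 2j − d_ρ), exp(2m − 2jλ − d_ρ))` EXACTLY, ★ `Valuation.map_add_of_distinct_val`).
[cite: Jacobowitz1962, §4] [cite: Kottwitz1986BaseChangeUnits, §1 pp. 240–241] -/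
theorem levelSetDep_eq_empty_of_not_gen_ramified (hD : IsRamifiedQuadraticDatum ρ α dρ t) (hΘΘ : ∀ x, Θ (Θ x) = x) (hΘρ : ∀ x, Θ (ρ x) = ρ (Θ x))
    (hvΘ : ∀ x, Valued.v (Θ x) = Valued.v x) (hρϖ : ρ ϖE = ϖE) (hϖE : Valued.v ϖE = exp (-2 : ℤ)) (hh : h ≠ 0)
    {μ : K} {m jl : ℕ} (hμ : Valued.v μ = Valued.v ϖE ^ m) (hjl : Valued.v (μ - ρ μ) = Valued.v (ϖE ^ jl * (α - ρ α)))
    {j a : ℕ} (ha : 1 ≤ a) (hoff : j + m ≠ jl + a) (hng : ¬ (a ≤ m ∧ (j ≤ m - a ∨ (2 * a ≤ m ∧ j + a ≤ jl)))) :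
    levelSetDep ρ Θ α ϖE h j a μ = ∅ := by
  ext Λ
  rw [mem_levelSetDep_iff]
  simp only [Set.mem_empty_iff_false, iff_false, not_and]
  intro hΛ hdep
  obtain ⟨x₀, hx₀, hΛx, hyO, hyN, hya⟩ := hΛ
  rw [dep_iff_of_witness_ramified hD hΘΘ hΘρ hvΘ hρϖ hϖE hh hμ hx₀ hΛx hya] at hdep
  obtain ⟨ham, hor⟩ := hdep
  rcases hor with hjam | hbd
  · exact hng ⟨ham, Or.inl (by omega)⟩
  simp only [dualGen] at hyO hyN hya hbd
  obtain ⟨hz, hκ⟩ := v_depthUnit_sub_map_eq_ramified hD hρϖ hϖE hh hμ hjl ham hx₀ hya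
  obtain ⟨hpos, -, -⟩ := v_one_add_twist_of_gen_ramified hD hvΘ hρϖ hϖE hh hx₀ hyO hyN hya
  have hθ := hpos ha
  have hne : Valued.v (1 + ρ h / h * (ρ (x₀ * Θ x₀) / (x₀ * Θ x₀))) ≠ Valued.v (ρ μ / μ - 1) := by
    rw [hθ, hκ, Ne, exp_inj]; omega
  rw [hz, Valuation.map_add_of_distinct_val _ hne, hθ, hκ, max_le_iff, exp_le_exp, exp_le_exp] at hbd
  exact hng ⟨ham, Or.inr ⟨by omega, by omega⟩⟩

/-- **(D1)+(D2) PACKAGED — THE GENERIC DEPTH RULE, M∕E RAMIFIED (sheet v5 `levelSetDep_eq_of_generic`)**: off the coincidence diagonal `j + m ≠ jλ + a`, and on it whenever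
`GEN` holds, `levelSetDep(j,a;μ) = if GEN then levelSet(j,a) else ∅` (`GEN := a ≤ m ∧ (j ≤ m − a ∨ (2a ≤ m ∧ j + a ≤ jλ))`; `j ≤ jλ` makes `GEN` automatic at `a = 0`).
[cite: Jacobowitz1962, §4] [cite: Kottwitz1986BaseChangeUnits, §1 pp. 240–241] -/
theorem levelSetDep_eq_of_generic_ramified (hD : IsRamifiedQuadraticDatum ρ α dρ t) (hΘΘ : ∀ x, Θ (Θ x) = x) (hΘρ : ∀ x, Θ (ρ x) = ρ (Θ x))
    (hvΘ : ∀ x, Valued.v (Θ x) = Valued.v x) (hρϖ : ρ ϖE = ϖE) (hϖE : Valued.v ϖE = exp (-2 : ℤ)) (hh : h ≠ 0)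
    {μ : K} {m jl : ℕ} (hμ : Valued.v μ = Valued.v ϖE ^ m) (hjl : Valued.v (μ - ρ μ) = Valued.v (ϖE ^ jl * (α - ρ α)))
    {j a : ℕ} (hj : j ≤ jl) (hoff : j + m ≠ jl + a ∨ (a ≤ m ∧ (j ≤ m - a ∨ (2 * a ≤ m ∧ j + a ≤ jl)))) :
    levelSetDep ρ Θ α ϖE h j a μ = if a ≤ m ∧ (j ≤ m - a ∨ (2 * a ≤ m ∧ j + a ≤ jl)) then levelSet ρ Θ α ϖE h j a else ∅ := by
  split_ifs with hgen
  · rcases Nat.eq_zero_or_pos a with rfl | ha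
    · exact levelSetDep_zero_eq_of_ramified hD hΘΘ hΘρ hvΘ hρϖ hϖE hh hμ hjl hj
    · exact levelSetDep_eq_levelSet_of_gen_ramified hD hΘΘ hΘρ hvΘ hρϖ hϖE hh hμ hjl ha hgen
  · have ha : 1 ≤ a := by
      rcases Nat.eq_zero_or_pos a with rfl | ha
      · exact absurd ⟨Nat.zero_le _, Or.inr ⟨by omega, by omega⟩⟩ hgen
      · exact ha
    have hoff' : j + m ≠ jl + a := by
      rcases hoff with h | h
      · exact h
      · exact absurd h hgen
    exact levelSetDep_eq_empty_of_not_gen_ramified hD hΘΘ hΘρ hvΘ hρϖ hϖE hh hμ hjl ha hoff' hgen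

/-- **THE GENERIC RULE, COUNTED**: `#levelSetDep(j,a;μ) = if GEN then #levelSet(j,a) else 0` (same hypotheses). [cite: Jacobowitz1962, §4] -/
theorem ncard_levelSetDep_eq_of_generic_ramified (hD : IsRamifiedQuadraticDatum ρ α dρ t) (hΘΘ : ∀ x, Θ (Θ x) = x) (hΘρ : ∀ x, Θ (ρ x) = ρ (Θ x))
    (hvΘ : ∀ x, Valued.v (Θ x) = Valued.v x) (hρϖ : ρ ϖE = ϖE) (hϖE : Valued.v ϖE = exp (-2 : ℤ)) (hh : h ≠ 0)
    {μ : K} {m jl : ℕ} (hμ : Valued.v μ = Valued.v ϖE ^ m) (hjl : Valued.v (μ - ρ μ) = Valued.v (ϖE ^ jl * (α - ρ α)))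
    {j a : ℕ} (hj : j ≤ jl) (hoff : j + m ≠ jl + a ∨ (a ≤ m ∧ (j ≤ m - a ∨ (2 * a ≤ m ∧ j + a ≤ jl)))) :
    (levelSetDep ρ Θ α ϖE h j a μ).ncard = if a ≤ m ∧ (j ≤ m - a ∨ (2 * a ≤ m ∧ j + a ≤ jl)) then (levelSet ρ Θ α ϖE h j a).ncard else 0 := by
  rw [levelSetDep_eq_of_generic_ramified hD hΘΘ hΘρ hvΘ hρϖ hϖE hh hμ hjl hj hoff]
  split_ifs
  · rfl
  · exact Set.ncard_empty _

end Summit.HodgeConjecture.HodgeConjecture.Cruxes.H413.F0P3cDyRamToricLevelCensusRamM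

end
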